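import Literature.Geometry.Riemannian.ClopenSubmanifoldHarmonic
import Literature.Geometry.Riemannian.L2HarmonicOneFormsIsometry
import HarnessLib

/-!
# Finiteness of `ℋ¹` without connectedness (Carron's memoir, Thm. 4.3, `k = 1`, first assertion)

Ninth layer of the proof programme of the named fact
`Literature.Geometry.Riemannian.Carron1999_finrank_l2HarmonicOneForms_le`. The finiteness
theorem `module_finite_l2HarmonicOneForms_of_boundarylessManifold`
(`L2HarmonicOneFormsIsometry.lean`) assumes `X` connected (through Hopf–Rinow cut-offs); the
fact quantifies over all manifolds without boundary. Here connectedness is removed by working on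
the connected components `C`, which are open-and-closed submanifolds (manifolds are locally
connected), complete, satisfying `(S_p)` with the same constant and with
`∫_C |Ric|^{p/2} ≤ ∫_X |Ric|^{p/2}` for the restricted metric (`ClopenSubmanifoldMetric.lean`,
`ClopenSubmanifoldHarmonic.lean`):

* only finitely many components carry `‖Ric‖_{L^{p/2}(C)} > μ/16` (they are disjoint and
  `∫_X |Ric|^{p/2} < ∞`); on every other component `ℋ¹(C) = 0` by Carron's vanishing theorem
  (memoir Prop. 4.2, `l2HarmonicOneForms_eq_bot_of_small_ricci_of_boundarylessManifold`);
* restriction `ℋ¹(X) → Π_{C big} ℋ¹(C)` is therefore injective, and each `ℋ¹(C)` is finite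
  dimensional (`module_finite_l2HarmonicOneForms_of_boundarylessManifold`).

Main results: `locallyConnectedSpace_of_boundarylessManifold`,
`module_finite_l2HarmonicOneForms_of_isGeodesicallyComplete` (and its restatement
`Carron1999_moduleFinite_l2HarmonicOneForms` in the binders of the named fact) — **on a complete Riemannian
manifold without boundary satisfying `(S_p)` (`p > 2`, `μ > 0`) with `∫ |Ric|^{p/2} < ∞`, the
space of `L²` harmonic `1`-forms is finite dimensional** (Carron 1999HdR, Thm. 4.3, `k = 1`, first
assertion, in the generality of the named fact);
`l2HarmonicOneForms_eq_bot_of_small_ricci_of_isGeodesicallyComplete` (Prop. 4.2 without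
connectedness) and `Carron1999_finrank_l2HarmonicOneForms_le_of_small_ricci` (the conclusion of
the named fact when `‖|Ric|‖_{L^{p/2}} ≤ μ/16`, where `ℋ¹ = 0`). Everything is proved; no
definitions, no named facts (D-0026). The linear dimension bound of Thm. 4.3 is not addressed.

## References

* G. Carron, *Formes harmoniques L² sur les variétés riemanniennes non-compactes*, mémoire
  d'habilitation (1999) = Rend. Mat. Appl. (7) 21 (2001), §4.b, Prop. 4.2, Thm. 4.3.
  [`Carron1999HdR`]
* G. Carron, *L²-cohomologie et inégalités de Sobolev*, Math. Ann. 314 (1999) 613–639.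
  [`Carron1999`]
-/

noncomputable section

open Bundle Set Function Filter Topology MeasureTheory Manifold
open scoped Manifold ContDiff ENNReal NNReal

namespace Literature.Geometry.Riemannian

open Literature.Geometry.Lorentzian
open Literature.Geometry.Lorentzian.PseudoRiemannianMetric
open Literature.Geometry.Manifold

/-! ### Manifolds without boundary are locally connected -/

/-- A `C^∞` manifold without boundary over a finite-dimensional real model is locally connected
(its recharted copy over `ℝ^m`, `ExtRechart`, has the same topology and is charted on the locally
connected space `ℝ^m`). [folklore] -/
theorem locallyConnectedSpace_of_boundarylessManifold
    {E : Type*} [NormedAddCommGroup E] [NormedSpace ℝ E] [FiniteDimensional ℝ E] {H : Type*}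
    [TopologicalSpace H] (I : ModelWithCorners ℝ E H) (X : Type*) [TopologicalSpace X]
    [ChartedSpace H X] [IsManifold I ∞ X] [BoundarylessManifold I X] :
    LocallyConnectedSpace X := by
  set m : ℕ := Module.finrank ℝ E with hm
  have hdim : Module.finrank ℝ (EuclideanSpace ℝ (Fin m)) = Module.finrank ℝ E := by simp [hm]
  set e : E ≃L[ℝ] EuclideanSpace ℝ (Fin m) := ContinuousLinearEquiv.ofFinrankEq hdim.symm with he
  haveI : IsManifold I 1 X := IsManifold.of_le (n := ∞) (by norm_num)
  have : LocallyConnectedSpace (ExtRechart I e X) :=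
    ChartedSpace.locallyConnectedSpace (EuclideanSpace ℝ (Fin m)) (ExtRechart I e X)
  exact this

/-! ### Finitely many components carry much curvature -/

/-- If pairwise disjoint measurable sets each carry integral `> c > 0` of a function of finite
total integral, there are finitely many of them. [folklore] -/
theorem Set.finite_of_forall_lt_setLIntegral {X : Type*} [MeasurableSpace X] (ν : Measure X)
    (ρ : X → ℝ≥0∞) (hρ : ∫⁻ x, ρ x ∂ν ≠ ⊤) {c : ℝ≥0∞} (hc : c ≠ 0) (S : Set (Set X))
    (hm : ∀ C ∈ S, MeasurableSet C) (hdisj : S.PairwiseDisjoint id)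
    (hbig : ∀ C ∈ S, c < ∫⁻ x in C, ρ x ∂ν) : S.Finite := by
  by_contra hinf
  obtain ⟨n, hn⟩ := ENNReal.exists_nat_mul_gt hc hρ
  obtain ⟨t, htS, htcard⟩ := Set.Infinite.exists_subset_card_eq hinf n
  have hdisj' : Set.PairwiseDisjoint (↑t : Set (Set X)) (id : Set X → Set X) :=
    hdisj.subset htS
  have hsum : ∑ C ∈ t, ∫⁻ x in C, ρ x ∂ν ≤ ∫⁻ x, ρ x ∂ν := by
    calc ∑ C ∈ t, ∫⁻ x in C, ρ x ∂ν = ∫⁻ x in ⋃ C ∈ t, C, ρ x ∂ν :=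
          (lintegral_biUnion_finset (t := fun C : Set X ↦ C) hdisj' (fun C hC ↦ hm C (htS hC)) ρ).symm
      _ ≤ ∫⁻ x, ρ x ∂ν := lintegral_mono' Measure.restrict_le_self le_rfl
  have hlow : (n : ℝ≥0∞) * c ≤ ∑ C ∈ t, ∫⁻ x in C, ρ x ∂ν := by
    calc (n : ℝ≥0∞) * c = ∑ _C ∈ t, c := by rw [Finset.sum_const, htcard, nsmul_eq_mul]
      _ ≤ ∑ C ∈ t, ∫⁻ x in C, ρ x ∂ν := Finset.sum_le_sum fun C hC ↦ (hbig C (htS hC)).le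
  exact absurd (hn.trans_le (hlow.trans hsum)) (lt_irrefl _)

/-! ### The finiteness theorem without connectedness -/

/-- **Carron 1999HdR, Thm. 4.3 (`k = 1`), first assertion, without connectedness.** Let `X` be
a `C^∞` manifold without boundary over a finite-dimensional real model, with a smooth
geodesically complete Riemannian metric `h` satisfying the Sobolev inequality `(S_p)` (`p > 2`,
`μ > 0`) and `∫ |Ric|^{p/2} dV_h < ∞`. Then the space `ℋ¹(X, h)` of `L²` harmonic `1`-forms is
finite dimensional. Proof: the connected components are open-and-closed submanifolds, complete
(`isGeodesicallyComplete_opens`), with `(S_p)` (`hasSobolevInequality_opens`) and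
`∫_C |Ric|^{p/2} ≤ ∫_X |Ric|^{p/2}` (`lintegral_normSq_ricci_rpow_opens`); only finitely many carry
`‖Ric‖_{L^{p/2}(C)} > μ/16` (`Set.finite_of_forall_lt_setLIntegral`), on the others `ℋ¹(C) = 0`
(Prop. 4.2, `l2HarmonicOneForms_eq_bot_of_small_ricci_of_boundarylessManifold`), so restriction to
the big components (`restrict_mem_l2HarmonicOneForms_opens`) is an injective linear map into a
finite product of finite-dimensional spaces
(`module_finite_l2HarmonicOneForms_of_boundarylessManifold`). [cite: Carron1999HdR, §4.b, Thm. 4.3] -/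
theorem module_finite_l2HarmonicOneForms_of_isGeodesicallyComplete
    {E : Type*} [NormedAddCommGroup E] [NormedSpace ℝ E] [FiniteDimensional ℝ E] {H : Type*}
    [TopologicalSpace H] (I : ModelWithCorners ℝ E H) (X : Type*) [TopologicalSpace X]
    [ChartedSpace H X] [IsManifold I ∞ X] [BoundarylessManifold I X] [T3Space X]
    [SecondCountableTopology X] [MeasurableSpace X] [BorelSpace X]
    (h : ContMDiffRiemannianMetric I ∞ E (TangentSpace I : X → Type _))
    [(ofRiemannian h).HasLeviCivita] {p μ : ℝ} (hp : 2 < p) (hμ : 0 < μ)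
    (hc : IsGeodesicallyComplete (ofRiemannian h).leviCivita) (hS : HasSobolevInequality h p μ)
    (hRic : ∫⁻ x, ENNReal.ofReal (((ofRiemannian h).normSq x ((ofRiemannian h).ricci x)) ^
        (p / 4)) ∂riemannianMeasure h ≠ ⊤) :
    Module.Finite ℝ (l2HarmonicOneForms h) := by
  classical
  haveI : LocallyConnectedSpace X := locallyConnectedSpace_of_boundarylessManifold I X
  have hp0 : 0 < p := by linarith
  -- the curvature density and the threshold
  set ρ : X → ℝ≥0∞ := fun x ↦ ENNReal.ofReal (((ofRiemannian h).normSq x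
    ((ofRiemannian h).ricci x)) ^ (p / 4)) with hρ
  set c : ℝ≥0∞ := ENNReal.ofReal (μ / 16) ^ (p / 2) with hcdef
  have hc0 : c ≠ 0 := (ENNReal.rpow_pos (ENNReal.ofReal_pos.2 (by positivity))
    ENNReal.ofReal_ne_top).ne'
  have hcpow : c ^ (2 / p) = ENNReal.ofReal (μ / 16) := by
    rw [hcdef, ← ENNReal.rpow_mul, show p / 2 * (2 / p) = 1 by field_simp, ENNReal.rpow_one]
  -- the components as open-and-closed submanifolds with the restricted metrics
  set U : X → TopologicalSpace.Opens X := fun x ↦ ⟨connectedComponent x, isOpen_connectedComponent⟩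
    with hUdef
  have hUc : ∀ x, IsClosed (U x : Set X) := fun x ↦ isClosed_connectedComponent
  have hmemU : ∀ x, x ∈ U x := fun x ↦ mem_connectedComponent
  choose hU hUeq using fun x ↦ exists_contMDiffRiemannianMetric_opens h (U x)
  haveI hconn : ∀ x, ConnectedSpace (U x) := fun x ↦
    isConnected_iff_connectedSpace.1 isConnected_connectedComponent
  haveI hLC : ∀ x, (ofRiemannian (hU x)).HasLeviCivita := fun x ↦
    PseudoRiemannianMetric.hasLeviCivita _
  have hcU : ∀ x, IsGeodesicallyComplete (ofRiemannian (hU x)).leviCivita := fun x ↦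
    isGeodesicallyComplete_opens (hUc x) (hUeq x) hc
  have hSU : ∀ x, HasSobolevInequality (hU x) p μ := fun x ↦
    hasSobolevInequality_opens (hUc x) (hUeq x) hp hS
  have hRicUeq : ∀ x, ∫⁻ u, ENNReal.ofReal (((ofRiemannian (hU x)).normSq u
      ((ofRiemannian (hU x)).ricci u)) ^ (p / 4)) ∂riemannianMeasure (hU x) =
      ∫⁻ y in (U x : Set X), ρ y ∂riemannianMeasure h := fun x ↦
    lintegral_normSq_ricci_rpow_opens (hUc x) (hUeq x) p
  have hRicU : ∀ x, ∫⁻ u, ENNReal.ofReal (((ofRiemannian (hU x)).normSq u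
      ((ofRiemannian (hU x)).ricci u)) ^ (p / 4)) ∂riemannianMeasure (hU x) ≠ ⊤ := fun x ↦ by
    rw [hRicUeq x]
    exact (lt_of_le_of_lt (lintegral_mono' Measure.restrict_le_self le_rfl)
      (lt_top_iff_ne_top.2 hRic)).ne
  -- restriction of forms to a component
  have hres : ∀ x, ∀ α ∈ l2HarmonicOneForms h,
      (fun u : U x ↦ (α u.1 : TangentSpace I u →L[ℝ] ℝ)) ∈ l2HarmonicOneForms (hU x) :=
    fun x α hα ↦ restrict_mem_l2HarmonicOneForms_opens (hUc x) (hUeq x) hα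
  -- small components carry no `L²` harmonic `1`-form
  have hsmall : ∀ x, ∫⁻ y in (U x : Set X), ρ y ∂riemannianMeasure h ≤ c →
      ∀ α ∈ l2HarmonicOneForms h, α x = 0 := by
    intro x hx α hα
    have hbot : l2HarmonicOneForms (hU x) = ⊥ := by
      refine l2HarmonicOneForms_eq_bot_of_small_ricci_of_boundarylessManifold I (U x) (hU x) hp hμ
        (hcU x) (hSU x) ?_
      rw [hRicUeq x, ← hcpow]
      exact ENNReal.rpow_le_rpow hx (by positivity)
    have h0 := (Submodule.eq_bot_iff _).1 hbot _ (hres x α hα)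
    have := congrFun h0 ⟨x, hmemU x⟩
    exact this
  -- the big components
  set S : Set (Set X) := {C | ∃ x, C = connectedComponent x ∧
    c < ∫⁻ y in C, ρ y ∂riemannianMeasure h} with hSdef
  have hSfin : S.Finite := by
    refine Set.finite_of_forall_lt_setLIntegral (riemannianMeasure h) ρ hRic hc0 S
      (fun C ⟨x, hCx, _⟩ ↦ hCx ▸ isClosed_connectedComponent.measurableSet) ?_
      (fun C ⟨x, _, hC⟩ ↦ hC)
    rintro C₁ ⟨x₁, rfl, -⟩ C₂ ⟨x₂, rfl, -⟩ hne
    exact connectedComponent_disjoint hne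
  haveI : Finite S := hSfin.to_subtype
  -- representatives of the big components
  have hrep : ∀ C : S, ∃ x : X, (C : Set X) = connectedComponent x := fun C ↦
    ⟨C.2.choose, C.2.choose_spec.1⟩
  choose rep hrep using hrep
  -- the restriction map into the finite product
  haveI hfinC : ∀ C : S, Module.Finite ℝ (l2HarmonicOneForms (hU (rep C))) := fun C ↦
    module_finite_l2HarmonicOneForms_of_boundarylessManifold I (U (rep C)) (hU (rep C)) hp hμ
      (hcU _) (hSU _) (hRicU _)
  set R : l2HarmonicOneForms h →ₗ[ℝ] (Π C : S, l2HarmonicOneForms (hU (rep C))) :=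
    { toFun := fun α C ↦ ⟨fun u : U (rep C) ↦ ((α : Π x : X, TangentSpace I x →L[ℝ] ℝ) u.1 :
        TangentSpace I u →L[ℝ] ℝ), hres (rep C) _ α.2⟩
      map_add' := fun α β ↦ funext fun C ↦ Subtype.ext (funext fun u ↦ rfl)
      map_smul' := fun r α ↦ funext fun C ↦ Subtype.ext (funext fun u ↦ rfl) } with hR
  haveI : Module.Finite ℝ (Π C : S, l2HarmonicOneForms (hU (rep C))) := Module.Finite.pi
  refine FiniteDimensional.of_injective (K := ℝ) (V := l2HarmonicOneForms h)
    (V₂ := Π C : S, l2HarmonicOneForms (hU (rep C))) R ?_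
  suffices hker : ∀ α : l2HarmonicOneForms h, R α = 0 → α = 0 by
    intro α β hαβ
    refine sub_eq_zero.1 (hker (α - β) (funext fun C ↦ ?_))
    have hC := congrFun hαβ C
    refine Subtype.ext (funext fun u ↦ ?_)
    have hu := congrArg (fun γ : l2HarmonicOneForms (hU (rep C)) ↦
      (γ : Π u : U (rep C), TangentSpace I u →L[ℝ] ℝ) u) hC
    exact sub_eq_zero.2 hu
  intro α hα
  refine Subtype.ext (funext fun x ↦ ?_)
  show (α : Π x : X, TangentSpace I x →L[ℝ] ℝ) x = 0
  by_cases hx : c < ∫⁻ y in (U x : Set X), ρ y ∂riemannianMeasure h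
  · -- `x` lies in a big component
    have hCS : (connectedComponent x) ∈ S := ⟨x, rfl, hx⟩
    set C : S := ⟨connectedComponent x, hCS⟩ with hC
    have hxC : x ∈ U (rep C) := by
      show x ∈ connectedComponent (rep C)
      rw [← hrep C]
      exact mem_connectedComponent
    have h1 := congrFun hα C
    simp only [hR, LinearMap.coe_mk, AddHom.coe_mk, Pi.zero_apply] at h1
    have h2 := congrArg (fun γ : l2HarmonicOneForms (hU (rep C)) ↦
      (γ : Π u : U (rep C), TangentSpace I u →L[ℝ] ℝ) ⟨x, hxC⟩) h1
    exact h2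
  · exact hsmall x (not_lt.1 hx) _ α.2

/-! ### The first assertion of the named fact -/

/-- **The first conjunct of `Carron1999_finrank_l2HarmonicOneForms_le`, proved.** In the exact
setting of the named fact `Literature.Geometry.Riemannian.Carron1999_finrank_l2HarmonicOneForms_le`
(Carron 1999 = memoir Thm. 4.3, `k = 1`): for a `C^∞` manifold `X` without boundary over a
finite-dimensional real model, with a smooth geodesically complete Riemannian metric `h`
satisfying `(S_p)` (`p > 2`, `μ > 0`) and `∫ (|Ric|²)^{p/4} dV_h < ∞`, the space `ℋ¹(X, h)` is
finite dimensional. (The second conjunct of the fact, the linear bound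
`dim ℋ¹ ≤ C(n, p, μ) ∫ |Ric|^{p/2}`, is Carron's Cwikel–Lieb–Rozenblum-type estimate and is not
proved in the tree.) [cite: Carron1999HdR, §4.b, Thm. 4.3] -/
theorem Carron1999_moduleFinite_l2HarmonicOneForms {p μ : ℝ} (hp : 2 < p) (hμ : 0 < μ)
    {E : Type*} [NormedAddCommGroup E] [NormedSpace ℝ E] [FiniteDimensional ℝ E] {H : Type*}
    [TopologicalSpace H] (I : ModelWithCorners ℝ E H) (X : Type*) [TopologicalSpace X]
    [ChartedSpace H X] [IsManifold I ∞ X] [BoundarylessManifold I X] [T3Space X]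
    [SecondCountableTopology X] [MeasurableSpace X] [BorelSpace X]
    (h : ContMDiffRiemannianMetric I ∞ E (TangentSpace I : X → Type _))
    [(ofRiemannian h).HasLeviCivita]
    (hc : IsGeodesicallyComplete (ofRiemannian h).leviCivita) (hS : HasSobolevInequality h p μ)
    (hRic : ∫⁻ x, ENNReal.ofReal (((ofRiemannian h).normSq x ((ofRiemannian h).ricci x)) ^
        (p / 4)) ∂riemannianMeasure h < ⊤) :
    Module.Finite ℝ (l2HarmonicOneForms h) :=
  module_finite_l2HarmonicOneForms_of_isGeodesicallyComplete I X h hp hμ hc hS hRic.ne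

/-! ### The vanishing theorem without connectedness; the fact in the small-curvature regime -/

/-- **Carron 1999HdR, Prop. 4.2 (`k = 1`), without connectedness.** On a geodesically complete
Riemannian manifold without boundary satisfying `(S_p)` (`p > 2`, `μ > 0`) with
`‖|Ric|‖_{L^{p/2}} = (∫ (|Ric|²)^{p/4})^{2/p} ≤ μ/16`, every `L²` harmonic `1`-form vanishes: each
connected component `C` (an open-and-closed submanifold, complete, with `(S_p)` and
`∫_C ≤ ∫_X`) has `ℋ¹(C) = 0` by the connected case
(`l2HarmonicOneForms_eq_bot_of_small_ricci_of_boundarylessManifold`), and a form vanishing on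
every component vanishes. [cite: Carron1999HdR, §4.b, Prop. 4.2] -/
theorem l2HarmonicOneForms_eq_bot_of_small_ricci_of_isGeodesicallyComplete
    {E : Type*} [NormedAddCommGroup E] [NormedSpace ℝ E] [FiniteDimensional ℝ E] {H : Type*}
    [TopologicalSpace H] (I : ModelWithCorners ℝ E H) (X : Type*) [TopologicalSpace X]
    [ChartedSpace H X] [IsManifold I ∞ X] [BoundarylessManifold I X] [T3Space X]
    [SecondCountableTopology X] [MeasurableSpace X] [BorelSpace X]
    (h : ContMDiffRiemannianMetric I ∞ E (TangentSpace I : X → Type _))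
    [(ofRiemannian h).HasLeviCivita] {p μ : ℝ} (hp : 2 < p) (hμ : 0 < μ)
    (hc : IsGeodesicallyComplete (ofRiemannian h).leviCivita) (hS : HasSobolevInequality h p μ)
    (hRic : (∫⁻ x, ENNReal.ofReal (((ofRiemannian h).normSq x ((ofRiemannian h).ricci x)) ^
        (p / 4)) ∂riemannianMeasure h) ^ (2 / p) ≤ ENNReal.ofReal (μ / 16)) :
    l2HarmonicOneForms h = ⊥ := by
  classical
  haveI : LocallyConnectedSpace X := locallyConnectedSpace_of_boundarylessManifold I X
  have hp0 : 0 < p := by linarith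
  rw [Submodule.eq_bot_iff]
  intro α hα
  funext x
  -- the component of `x` as an open-and-closed submanifold
  set U : TopologicalSpace.Opens X := ⟨connectedComponent x, isOpen_connectedComponent⟩ with hUdef
  have hUc : IsClosed (U : Set X) := isClosed_connectedComponent
  obtain ⟨hU, hUeq⟩ := exists_contMDiffRiemannianMetric_opens h U
  haveI : ConnectedSpace U := isConnected_iff_connectedSpace.1 isConnected_connectedComponent
  haveI : (ofRiemannian hU).HasLeviCivita := PseudoRiemannianMetric.hasLeviCivita _
  have hRicU : (∫⁻ u, ENNReal.ofReal (((ofRiemannian hU).normSq u ((ofRiemannian hU).ricci u)) ^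
      (p / 4)) ∂riemannianMeasure hU) ^ (2 / p) ≤ ENNReal.ofReal (μ / 16) := by
    rw [lintegral_normSq_ricci_rpow_opens hUc hUeq p]
    exact (ENNReal.rpow_le_rpow (lintegral_mono' Measure.restrict_le_self le_rfl)
      (by positivity)).trans hRic
  have hbot : l2HarmonicOneForms hU = ⊥ :=
    l2HarmonicOneForms_eq_bot_of_small_ricci_of_boundarylessManifold I U hU hp hμ
      (isGeodesicallyComplete_opens hUc hUeq hc) (hasSobolevInequality_opens hUc hUeq hp hS) hRicU
  have h0 := (Submodule.eq_bot_iff _).1 hbot _ (restrict_mem_l2HarmonicOneForms_opens hUc hUeq hα)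
  exact congrFun h0 ⟨x, mem_connectedComponent⟩

/-- **The named fact in the small-curvature regime.** Under the hypotheses of
`Carron1999_finrank_l2HarmonicOneForms_le` and `‖|Ric|‖_{L^{p/2}} ≤ μ/16`, its conclusion holds
with any constant `C`: `ℋ¹(X, h)` is finite dimensional of dimension `0`
(`l2HarmonicOneForms_eq_bot_of_small_ricci_of_isGeodesicallyComplete`). The general linear bound
(Carron's Cwikel–Lieb–Rozenblum-type estimate) is not proved in the tree.
[cite: Carron1999HdR, §4.b, Prop. 4.2 and Thm. 4.3] -/
theorem Carron1999_finrank_l2HarmonicOneForms_le_of_small_ricci {p μ : ℝ} (hp : 2 < p)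
    (hμ : 0 < μ) (C : ℝ≥0)
    {E : Type*} [NormedAddCommGroup E] [NormedSpace ℝ E] [FiniteDimensional ℝ E] {H : Type*}
    [TopologicalSpace H] (I : ModelWithCorners ℝ E H) (X : Type*) [TopologicalSpace X]
    [ChartedSpace H X] [IsManifold I ∞ X] [BoundarylessManifold I X] [T3Space X]
    [SecondCountableTopology X] [MeasurableSpace X] [BorelSpace X]
    (h : ContMDiffRiemannianMetric I ∞ E (TangentSpace I : X → Type _))
    [(ofRiemannian h).HasLeviCivita]
    (hc : IsGeodesicallyComplete (ofRiemannian h).leviCivita) (hS : HasSobolevInequality h p μ)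
    (hRic : (∫⁻ x, ENNReal.ofReal (((ofRiemannian h).normSq x ((ofRiemannian h).ricci x)) ^
        (p / 4)) ∂riemannianMeasure h) ^ (2 / p) ≤ ENNReal.ofReal (μ / 16)) :
    Module.Finite ℝ (l2HarmonicOneForms h) ∧
      (Module.finrank ℝ (l2HarmonicOneForms h) : ℝ≥0∞) ≤
        C * ∫⁻ x, ENNReal.ofReal (((ofRiemannian h).normSq x ((ofRiemannian h).ricci x)) ^
          (p / 4)) ∂riemannianMeasure h := by
  have hbot := l2HarmonicOneForms_eq_bot_of_small_ricci_of_isGeodesicallyComplete I X h hp hμ hc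
    hS hRic
  rw [hbot]
  refine ⟨Module.Finite.bot ℝ _, ?_⟩
  rw [finrank_bot]
  simp

end Literature.Geometry.Riemannian

end
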